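import Literature.NumberTheory.LFunctions.WeilTwoPrimeOddMarginIBase
import Literature.NumberTheory.LFunctions.WeilBlockRowsPZ
import HarnessLib

/-!
# Two-prime odd-margin certificate I: the Bessel block claim `Hp = C H Cᵀ`, rows 65–69

`WeilCert.checkHpRow` for rows 65–69 of certificate I (the exact Legendre cancellation `C H Cᵀ = diag(2a₀/(4i+3))`), by `decide +kernel`. Pure proof file.
-/

noncomputable section

namespace Literature.NumberTheory.LFunctions

set_option maxHeartbeats 0 in
/-- Row 65 of `C H Cᵀ` is row 65 of `Hp` (certificate I). [folklore] -/
theorem checkHpRow1_65_weilCert23I : weilCert23IBase.checkHpRow weilCert23IHp 1 65 = true := by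
  decide +kernel

set_option maxHeartbeats 0 in
/-- Row 66 of `C H Cᵀ` is row 66 of `Hp` (certificate I). [folklore] -/
theorem checkHpRow1_66_weilCert23I : weilCert23IBase.checkHpRow weilCert23IHp 1 66 = true := by
  decide +kernel

set_option maxHeartbeats 0 in
/-- Row 67 of `C H Cᵀ` is row 67 of `Hp` (certificate I). [folklore] -/
theorem checkHpRow1_67_weilCert23I : weilCert23IBase.checkHpRow weilCert23IHp 1 67 = true := by
  decide +kernel

set_option maxHeartbeats 0 in
/-- Row 68 of `C H Cᵀ` is row 68 of `Hp` (certificate I). [folklore] -/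
theorem checkHpRow1_68_weilCert23I : weilCert23IBase.checkHpRow weilCert23IHp 1 68 = true := by
  decide +kernel

set_option maxHeartbeats 0 in
/-- Row 69 of `C H Cᵀ` is row 69 of `Hp` (certificate I). [folklore] -/
theorem checkHpRow1_69_weilCert23I : weilCert23IBase.checkHpRow weilCert23IHp 1 69 = true := by
  decide +kernel

end Literature.NumberTheory.LFunctions
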